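import Summits.QuantumFields.YangMills.Theorems.BalabanUVNodesN15SmallFieldAllLayersLiveKnit
import Summits.QuantumFields.YangMills.Theorems.BalabanUVNodesN15SmallFieldUnitLayerDirichlet
import Summits.QuantumFields.YangMills.Theorems.BalabanUVNodesN15SizedKnitSocketDirichlet
import HarnessLib

/-!
# N15 = NE2 — PROGRAMME Ð (Ð-5): ★★★ THE ALL-LIVE KNIT WITH A GENUINE DIRICHLET REGION — `Live ∧ N15At` for dag-n15-c's live small-field family, OPERATOR + SITE + UNIT all reading `A′`,
# the UNIT conjunct on [B9] §E's `C^{(k)}_Λ(U)`-shaped Dirichlet covariance with `inΛ := inLamSf` (sites of Λ = B(Λ′₀)), on the sub-family «large cube × region containing the origin block»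
# (dag-n15-a g30, programme Ð «Dirichlet», FILE (Ð-5); node N15 = NE2; `--supports stmt-QuantumFields-27366 --as helper`, count-neutral; plumbing defs `RegIdx0`, `sfObjects₄covLam`, `wLam` + theorems; imports (L-5), (Ð-4), (Ð-6))

WHY.  (Ð-4) proved `NE2PlusUnit` BY NAME for the U-live Dirichlet unit kernel `foCovSfLam` with the GENUINE region predicate `inLamSf` on «large cube × ANY finite set of coarse sites Λ′₀».  The
node's `N15At` is read by K3⁸ under dag-n15-w2's guard `Live`, whose clause (G5) `inΛ_nonempty` asks every instance's region to be MET; so the knit lives on the regions whose coarse sites contain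
the origin (`RegIdx0`: `Λ ⊇ B(0)`, met by the origin of the unit torus — (Ð-4) `inLamSf_zero`); every region is of this form up to a translation of the torus.  This is (L-5) with (Ð-4) in place
of (L-4): the ONLY remaining `⊤` of (L-5)'s literal (`inΛ := fun _ _ => True`, ref-B READ-986 NIT (b) ∕ READ-989 (ii)) is replaced by the Dirichlet region predicate.

WHAT.  §0 (ns `…UnitLayerBgCol`) `transpose_elimCS_mul_kron_mul`, `elimCS_mul_kron_mul_transpose`, ★ `covCS_kron_one` (Λ-twin of (L-1) `covC_kron_one`: at a colour-diagonal form the coloured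
Dirichlet covariance IS the Literature's scalar `subFamilyT … .cov` colour by colour).  §1 `ne2PlusUnit_comp` (restriction of the unit conjunct along an index map, region and unit distance
included); abbrev `RegIdx0 d := {Λ'₀ // 0 ∈ Λ'₀}`; ★★ `live_sfGELam` (the sub-family `SfIdxGE d L w × RegIdx0 d` passes the guard for ANY kernels with `inΛ := inLamSf`: cofinal and
zero-potential-regular by (L-5) `live_sfGE`, (G5) by `inLamSf_zero`).  §1b CONSISTENCY: ★ `foCovSfLam_one` (at the zero potential the U-live Dirichlet kernel of (Ð-4) is `[j = j′]·covDiffLam`,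
`L^m ≥ w₀`), ★ `foCovSfLam_one_eq_covOnSLam` (= (Ð-6)'s U-BLIND Dirichlet kernel of record `covOnSLam` on Σ-E's socket reading of `sfInstance`, constant region map, times `δ_{jj′}` — the two
Dirichlet editions agree at `U ≡ 1`, as (L-5) `foCovSf_one_eq_covOnS` did for the torus).  §2 ★★★
**`live_and_n15At_sf₄cov_allLiveLam`**: `∃ w, Live ⟨…, inLamSf, dist⟩ ∧ N15At {…, Kunit := foCovSfLam, inΛ := inLamSf, …}` — OPERATOR = Σ-F `ne2PlusOperator_sf₄cov`, SITE = (J-c)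
`ne2PlusSite_foSiteSf`, UNIT = (Ð-4) `ne2PlusUnit_foCovSfLam`, all restricted along the projections.  §3 the road-(c) LITERAL `sfObjects₄covLam … w : NE2Objects₁₁` (`rfl` to the bundle),
`exists_live_and_n15At_sfObjects₄covLam`, pinned threshold `wLam` (a `Classical.choose` — NON-EXPLICIT cube floor, as `wAll`: FILE 133's `w₀` is existential; any re-pin keyed to it must say so),
★★★ `live_and_n15At_sfObjects₄covLam_wLam` (CLOSED literal: guard ∧ `N15At`, NO U-blind layer, NO `⊤` region), keyed face `s_N15_of_admits_sf₄covLam` (part 30's interface).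

HONEST FRAMING ∕ LIMITS.  By-name composition over landed rows + (Ð-4); MODEL objects exactly as n15-c FILE 130∕133∕145 and (J-b′)(H)(L-1)…(L-3)(Ð-1)…(Ð-4) (global small-field gauge; covariant
Laplacian ⊗ colour + FLAT nonlocal part (1.69), not (3.26); `Reg336` idle ∕ no `D^{(2)}` term of (3.156); King-block-mean pairing; doubled torus; `L ≥ 7`; large cubes above a non-explicit floor;
crude constants) — ref-B READ-989 items (i)(iii)(iv)(v)(vi) UNTOUCHED, item (ii) addressed for the UNIT conjunct (the operator and site conjuncts carry no region in their templates).  NOT [B9]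
Thms 3.1∕3.2∕3.15 AS PRINTED.  N15 stays DISCHARGED OF RECORD AS CONSUMED (U-blind v7 pin, p687738) — no re-pin asked (road (b)∕(c) re-pins are the PLAN's; a re-pin keyed to THIS literal
would fire FLAG №13 t2 by definition — the director's word, not mine), nothing re-claimed, no count moved (typed 28∕28 · discharged 8∕28); K3⁸ OPEN; one finite 𝕋⁴ at fixed ε per index — NOT
ℝ⁴ ∕ infinite volume ∕ OS ∕ mass gap ∕ Clay.  No `sorry`, `instance`, `notation`, `maxHeartbeats`; standard axioms.
[cite: Balaban1985BackgroundPropagators, Thm 3.1 (3.42) p.397, Thm 3.2 (3.48) p.398 + (3.132) p.422, Thm 3.15 (3.187) p.432 (quantifier templates), §E pp.427–428 (Dirichlet region); Balaban1984PropagatorsII, Lemma 2.4 p.245, (2.154)–(2.156) pp.249–250]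
-/

noncomputable section

open scoped BigOperators Matrix Matrix.Norms.Frobenius Kronecker

namespace Summit.QuantumFields.YangMills.BalabanUVNodes.N15.UnitLayerBgCol

open Literature.MathematicalPhysics.QuantumFieldTheory.Balaban1983to89
open Literature.MathematicalPhysics.QuantumFieldTheory.Balaban1983to89.B6Lemma24Torus (pbox)
open Literature.MathematicalPhysics.QuantumFieldTheory.Balaban1983to89.B6Cov2156Torus (freeT)
open Literature.MathematicalPhysics.QuantumFieldTheory.Balaban1983to89.B6Cov2156TorusSubset (elimTS subFamilyT subFamilyT_cov)
open Literature.MathematicalPhysics.QuantumFieldTheory.Balaban1983to89.T4Cov2156Rate (redCov)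

variable {d : ℕ} {L : ℕ} {M : Fin (d + 1) → ℕ} [∀ μ, NeZero (M μ)] {ι : Type} [Fintype ι] [DecidableEq ι] {S : Finset (B4.Idx (pbox M) (d + 1))} {hS : S ⊆ freeT L M}

/-! ## §1 The coloured Dirichlet covariance at a colour-diagonal form -/

omit [∀ μ, NeZero (M μ)] in
/-- `C_Sᵀ (A₀ ⊗ₖ 1) C_S = (C_S^{b06}ᵀ A₀ C_S^{b06}) ⊗ₖ 1`. [folklore] -/
theorem transpose_elimCS_mul_kron_mul (A₀ : Matrix (B4.Idx (pbox M) (d + 1)) (B4.Idx (pbox M) (d + 1)) ℝ) :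
    (elimCS L M ι S hS)ᵀ * (A₀ ⊗ₖ (1 : Matrix ι ι ℝ)) * elimCS L M ι S hS = ((elimTS L M S hS)ᵀ * A₀ * elimTS L M S hS) ⊗ₖ (1 : Matrix ι ι ℝ) := by
  rw [elimCS, ← Matrix.kroneckerMap_transpose, Matrix.transpose_one, ← Matrix.mul_kronecker_mul, ← Matrix.mul_kronecker_mul, Matrix.one_mul, Matrix.one_mul]

omit [∀ μ, NeZero (M μ)] in
/-- `C_S (X ⊗ₖ 1) C_Sᵀ = (C_S^{b06} X C_S^{b06}ᵀ) ⊗ₖ 1`. [folklore] -/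
theorem elimCS_mul_kron_mul_transpose (X : Matrix S S ℝ) :
    elimCS L M ι S hS * (X ⊗ₖ (1 : Matrix ι ι ℝ)) * (elimCS L M ι S hS)ᵀ = (elimTS L M S hS * X * (elimTS L M S hS)ᵀ) ⊗ₖ (1 : Matrix ι ι ℝ) := by
  rw [elimCS, ← Matrix.kroneckerMap_transpose, Matrix.transpose_one, ← Matrix.mul_kronecker_mul, ← Matrix.mul_kronecker_mul, Matrix.one_mul, Matrix.one_mul]

omit [∀ μ, NeZero (M μ)] in
/-- ★ **CONSISTENCY — AT A COLOUR-DIAGONAL FORM THE COLOURED DIRICHLET COVARIANCE IS THE LITERATURE's SCALAR DIRICHLET COVARIANCE COLOUR BY COLOUR**: `C_SᵀA₀C_S` invertible ⟹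
`covCS S (A₀ ⊗ₖ 1) = (subFamilyT L M S hS A₀).cov ⊗ₖ 1` (Λ-twin of (L-1) `covC_kron_one`; `subFamilyT … .cov = C_S(C_SᵀA₀C_S)⁻¹C_Sᵀ` is [B6] (2.156) on the sub-family, Literature `subFamilyT_cov`).
[cite: Balaban1984PropagatorsII, (2.156) p.250] -/
theorem covCS_kron_one {A₀ : Matrix (B4.Idx (pbox M) (d + 1)) (B4.Idx (pbox M) (d + 1)) ℝ} (hU : IsUnit ((elimTS L M S hS)ᵀ * A₀ * elimTS L M S hS).det) :
    covCS L M ι S hS (A₀ ⊗ₖ (1 : Matrix ι ι ℝ)) = (subFamilyT L M S hS A₀).cov ⊗ₖ (1 : Matrix ι ι ℝ) := by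
  have h1 : covCS L M ι S hS (A₀ ⊗ₖ (1 : Matrix ι ι ℝ)) = elimCS L M ι S hS * (((elimTS L M S hS)ᵀ * A₀ * elimTS L M S hS)⁻¹ ⊗ₖ (1 : Matrix ι ι ℝ)) * (elimCS L M ι S hS)ᵀ := by
    rw [covCS, redCov, transpose_elimCS_mul_kron_mul, kron_one_inv_eq ι (Matrix.mul_nonsing_inv _ hU)]
  rw [h1, elimCS_mul_kron_mul_transpose, subFamilyT_cov]
  congr!

end Summit.QuantumFields.YangMills.BalabanUVNodes.N15.UnitLayerBgCol

namespace Summit.QuantumFields.YangMills.BalabanUVNodes.N15.SiteLayerSf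

open Literature.MathematicalPhysics.QuantumFieldTheory.Balaban1983to89
open Literature.MathematicalPhysics.QuantumFieldTheory.Balaban1983to89.T4EtaRate (PairedInstance NE2PlusOperator NE2PlusSite NE2PlusUnit)
open Literature.MathematicalPhysics.QuantumFieldTheory.Balaban1983to89.B5Prop11Plancherel (Tor)
open Literature.Barriers.QuantumFields (traceForm)
open Summit.QuantumFields.YangMills.BalabanUVNodes.N15.Gluing (SfIdx sfInstance sfFamily CvX CvX' cvM cvBlk)
open Summit.QuantumFields.YangMills.BalabanUVNodes.N15.GenuineRecord (sfE₄cov ne2PlusOperator_sf₄cov)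
open Summit.QuantumFields.YangMills.BalabanUVNodes.N15.PairedFamilyGuard (Live)
open Literature.MathematicalPhysics.QuantumFieldTheory.Balaban1983to89.T4Continuum (T4Family ULoop)
open Node00 (NE2Objects₁₁)
open Summit.QuantumFields.YangMills.BalabanUVNodes.N15.AtKeyedHome (s_N15_of_admits)
open YMDAG.UVSplit (Datum RateCarriers RateRecordPred N15At S_N15 ne2OfRecord₁₁)
open Literature.MathematicalPhysics.QuantumFieldTheory.Balaban1983to89.B6Lemma24Torus (pbox)
open Literature.MathematicalPhysics.QuantumFieldTheory.Balaban1983to89.B6Cov2156Torus (deltaPol one_le_M freeT)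
open Literature.MathematicalPhysics.QuantumFieldTheory.Balaban1983to89.B6Cov2156TorusSubset (lamFree lamFree_subset subFamilyT)
open Literature.MathematicalPhysics.QuantumFieldTheory.Balaban1983to89.B6LowerBound2153Torus (rep rep_mem_pbox InLam)
open Literature.MathematicalPhysics.QuantumFieldTheory.Balaban1983to89.T4Cov2156Rate (isUnit_sandwich_subfamily)
open Summit.QuantumFields.YangMills.BalabanUVNodes.N15.MatrixSpecies (liftBlk)
open Summit.QuantumFields.YangMills.BalabanUVNodes.N15.UnitLayerBg (exDress exDress_zero)
open Summit.QuantumFields.YangMills.BalabanUVNodes.N15.UnitLayerBgCol (covCS covCS_kron_one kron_one_apply isUnit_det_smul_one_add_deltaCol)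
open Summit.QuantumFields.YangMills.BalabanUVNodes.N15.GluedZeroField (zLiveC zLiveF exists_zLive_zero)
open Summit.QuantumFields.YangMills.BalabanUVNodes.N15.GenuineRecord (sfTG covDiffLam covOnSLam covOnSLam_ker)

variable (d : ℕ) {L : ℕ} [NeZero L] (mm ι : Type) [Fintype mm] [DecidableEq mm] [Fintype ι] [DecidableEq ι] (a : ℝ) (e : Matrix mm mm ℂ ≃L[ℝ] (ι → ℝ))

/-! ## §1 Restriction of the unit conjunct; the origin-anchored regions; the guard -/

section Restrict

/-- `NE2PlusUnit` restricts along any index map (region predicate and unit distance included). [bookkeeping] -/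
theorem ne2PlusUnit_comp {I J : Type} (f : J → I) {c35 : ℝ} {pi : I → PairedInstance} {Kd : ∀ i, B9.SiteKernel (pi i).gc (pi i).Bf}
    {inΛ : ∀ i, (pi i).gc.Site → Prop} {ud : ∀ i, (pi i).gc.Site → (pi i).gc.Site → ℝ}
    (h : NE2PlusUnit c35 pi Kd inΛ ud) : NE2PlusUnit c35 (fun j => pi (f j)) (fun j => Kd (f j)) (fun j => inΛ (f j)) (fun j => ud (f j)) := by
  obtain ⟨δ₀, a₀, B₀, θ, h1, h2, h3, h4, h5, H⟩ := h
  exact ⟨δ₀, a₀, B₀, θ, h1, h2, h3, h4, h5, fun j => H (f j)⟩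

/-- **THE ORIGIN-ANCHORED REGIONS**: finite sets of coarse sites containing the origin — Dirichlet regions `Λ = B(Λ′₀) ⊇ B(0)` (every region is of this form up to a translation of the
torus; the anchor makes the guard's clause (G5) «the region is met» hold). [bookkeeping] -/
abbrev RegIdx0 (d : ℕ) : Type := {Λ'₀ : Finset (Fin (d + 1) → ℤ) // (0 : Fin (d + 1) → ℤ) ∈ Λ'₀}

omit [NeZero L] [Fintype mm] [DecidableEq mm] [Fintype ι] [DecidableEq ι] in
/-- `RegIdx0 d` is nonempty (`{0}`), so no product with it is emptied. [folklore] -/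
theorem regIdx0_nonempty : Nonempty (RegIdx0 d) := ⟨⟨{0}, Finset.mem_singleton_self _⟩⟩

omit [DecidableEq ι] in
/-- ★★ **THE SUB-FAMILY «LARGE CUBE × ORIGIN-ANCHORED REGION» PASSES THE K3⁸ GUARD WITH THE GENUINE REGION PREDICATE, FOR ANY KERNELS**: `(L^m, kk)` jointly cofinal and the zero potential
(3.35)∕(3.36)-regular ((L-5) `live_sfGE`, region-blind clauses), and every instance's region `Λ = B(Λ′₀) ∋ 0` is met by the origin of the unit torus ((Ð-4) `inLamSf_zero`). [bookkeeping] -/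
theorem live_sfGELam (hL : Odd L ∧ 1 < L) (w : ℝ) {c35 : ℝ} (hc35 : 0 ≤ c35) (p : ℝ)
    (Kop : ∀ x : SfIdxGE d L w × RegIdx0 d, B9.KernelFamily (sfInstance d mm ι hL x.1.1).gc (sfInstance d mm ι hL x.1.1).Bf)
    (Ksite Kunit : ∀ x : SfIdxGE d L w × RegIdx0 d, B9.SiteKernel (sfInstance d mm ι hL x.1.1).gc (sfInstance d mm ι hL x.1.1).Bf) :
    Live ⟨SfIdxGE d L w × RegIdx0 d, c35, p, fun x => sfInstance d mm ι hL x.1.1, Kop, Ksite, Kunit, fun x => inLamSf d mm ι hL x.1.1 x.2.1,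
      fun x => (sfInstance d mm ι hL x.1.1).gc.dist⟩ := by
  let r₀ : RegIdx0 d := ⟨{0}, Finset.mem_singleton_self _⟩
  refine ⟨fun M₅ k₀ => ?_, fun x α₀ hα₀ => ?_, fun x => ⟨(0 : Tor (cvM d L x.1.1.m x.1.1.kk hL)), inLamSf_zero d mm ι hL x.1.1 x.2.2⟩⟩
  · obtain ⟨i, hi⟩ := (live_sfGE d mm ι hL w hc35 p (fun i => Kop (i, r₀)) (fun i => Ksite (i, r₀)) (fun i => Kunit (i, r₀))).cofinal M₅ k₀
    exact ⟨(i, r₀), hi⟩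
  · exact (live_sfGE d mm ι hL w hc35 p (fun i => Kop (i, x.2)) (fun i => Ksite (i, x.2)) (fun i => Kunit (i, x.2))).reg_one x.1 α₀ hα₀

end Restrict

/-- THE UNIT-LATTICE SITE ONE BLOCK OVER FROM THE ORIGIN: `ȳ = L·e₀` (first coordinate `L`, the others `0`). [folklore] -/
def siteL (hL : Odd L ∧ 1 < L) (i : SfIdx d L) : Tor (cvM d L i.m i.kk hL) :=
  fun μ => ((if μ = 0 then L else 0 : ℕ) : ZMod (cvM d L i.m i.kk hL μ))

omit [Fintype mm] [DecidableEq mm] [Fintype ι] [DecidableEq ι] in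
/-- Its integer representative is `L·e₀` (`L < 2L^{m+1}` = the period). [folklore] -/
theorem rep_siteL (hL : Odd L ∧ 1 < L) (i : SfIdx d L) : rep (cvM d L i.m i.kk hL) (siteL d hL i) = fun μ => if μ = 0 then (L : ℤ) else 0 := by
  have hLpos : 0 < L := Nat.pos_of_ne_zero (NeZero.ne L)
  have hper : ∀ μ, cvM d L i.m i.kk hL μ = 2 * L ^ (i.m + 1) := fun μ => rfl
  have hlt : L < 2 * L ^ (i.m + 1) := by
    have h1 : L ≤ L ^ (i.m + 1) := by
      calc L = L ^ 1 := (pow_one L).symm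
        _ ≤ L ^ (i.m + 1) := Nat.pow_le_pow_right hLpos (by omega)
    omega
  funext μ
  simp only [rep, siteL, ZMod.val_natCast, hper]
  by_cases hμ : μ = 0
  · rw [if_pos hμ, if_pos hμ, Nat.mod_eq_of_lt hlt]
  · rw [if_neg hμ, if_neg hμ, Nat.zero_mod]; rfl

omit [DecidableEq mm] [DecidableEq ι] in
/-- ★ **THE SINGLE-BLOCK REGION `Λ = B(0)` IS INTERMEDIATE ON EVERY INSTANCE** (ref-B READ-993 NIT (a): the genuine `inΛ` must be exercised strictly between the empty region and the whole torus):
the origin lies in it (`inLamSf_zero`), the site one block over does NOT (`corner (L·e₀) = L·e₀ ≠ 0`, the period being `2L^{m+1} > L`).  Since `⟨{0}, _⟩ ∈ RegIdx0 d`, the knit of §2 contains this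
intermediate region at every cube. [folklore] -/
theorem inLamSf_singleton_intermediate (hL : Odd L ∧ 1 < L) (i : SfIdx d L) :
    inLamSf d mm ι hL i {0} (0 : Tor (cvM d L i.m i.kk hL)) ∧ ¬ inLamSf d mm ι hL i {0} (siteL d hL i) := by
  refine ⟨inLamSf_zero d mm ι hL i (Finset.mem_singleton_self _), fun h => ?_⟩
  have hLpos : 0 < L := Nat.pos_of_ne_zero (NeZero.ne L)
  have hlt : (L : ℤ) < ((2 * L ^ (i.m + 1) : ℕ) : ℤ) := by
    have h1 : L ≤ L ^ (i.m + 1) := by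
      calc L = L ^ 1 := (pow_one L).symm
        _ ≤ L ^ (i.m + 1) := Nat.pow_le_pow_right hLpos (by omega)
    exact_mod_cast (show L < 2 * L ^ (i.m + 1) by omega)
  have h' : InLam L (cvM d L i.m i.kk hL) {0} (rep (cvM d L i.m i.kk hL) (siteL d hL i)) := h
  unfold InLam at h'
  rw [Finset.mem_singleton] at h'
  have hrep0 : rep (cvM d L i.m i.kk hL) (siteL d hL i) 0 = (L : ℤ) := by rw [rep_siteL]; exact if_pos rfl
  have h0 : (L : ℤ) * ((rep (cvM d L i.m i.kk hL) (siteL d hL i) 0 % ((cvM d L i.m i.kk hL 0 : ℕ) : ℤ)) / (L : ℤ)) = 0 := congrFun h' 0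
  have hper : ((cvM d L i.m i.kk hL 0 : ℕ) : ℤ) = ((2 * L ^ (i.m + 1) : ℕ) : ℤ) := rfl
  rw [hrep0, hper, Int.emod_eq_of_lt (by positivity) hlt, Int.ediv_self (by exact_mod_cast hLpos.ne'), mul_one] at h0
  exact absurd h0 (by exact_mod_cast hLpos.ne')

/-! ## §1b Consistency at the zero potential: the U-live Dirichlet kernel is (Ð-6)'s U-blind Dirichlet kernel of record -/

/-- ★ **AT THE ZERO POTENTIAL THE U-LIVE DIRICHLET UNIT KERNEL IS `[j = j′]·(C^{(L^{k+r})}_Λ − C^{(L^k)}_Λ)`** (`d ≥ 1`, `L ≥ 7` odd, `a > 0`, indices with `L^m ≥ w₀`, trace-form-orthonormal `e`, ANY finite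
`Λ′₀`): both live background matrices vanish ((J-b′) `exists_zLive_zero`), both exact dressings vanish (V-A `exDress_zero`), and `covCS S (Δ^{(n)} ⊗ₖ 1) = (subFamilyT S Δ^{(n)}).cov ⊗ₖ 1` (§1, invertibility
by the Literature's `isUnit_sandwich_subfamily` = (2.157) on the sub-family) — the kernel is (Ð-6)'s `covDiffLam L M k r Λ'₀` at the King-block representatives, times `δ_{jj′}`.
[cite: Balaban1984PropagatorsII, (2.156)–(2.157) p.250; Balaban1984PropagatorsI, (1.71) p.30] -/
theorem foCovSfLam_one (hd : 1 ≤ d) (hL : Odd L ∧ 1 < L) (hL7 : 7 ≤ L) (ha : 0 < a) (α β : Fin (d + 1)) (j j' : ι) :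
    ∃ w₀ : ℝ, ∀ (i : SfIdx d L), w₀ ≤ ((L ^ i.m : ℕ) : ℝ) → (∀ A B : Matrix mm mm ℂ, traceForm A B = e A ⬝ᵥ e B) → ∀ (Λ'₀ : Finset (Fin (d + 1) → ℤ)) (y y' : Tor (cvM d L i.m i.kk hL)),
      (foCovSfLam d mm ι a e hL α β j j' i Λ'₀).ker (sfInstance d mm ι hL i).Bf.one y y' =
        if j = j' then covDiffLam L (cvM d L i.m i.kk hL) i.kk i.r Λ'₀ (⟨rep (cvM d L i.m i.kk hL) y, rep_mem_pbox (cvM d L i.m i.kk hL) y⟩, α)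
          (⟨rep (cvM d L i.m i.kk hL) y', rep_mem_pbox (cvM d L i.m i.kk hL) y'⟩, β) else 0 := by
  obtain ⟨w₀, H⟩ := exists_zLive_zero d mm ι a e hL hL7 ha
  refine ⟨w₀, fun i hw he Λ'₀ y y' => ?_⟩
  have hLpos : 0 < L := Nat.pos_of_ne_zero (NeZero.ne L)
  have hLk : 1 ≤ L ^ i.kk := Nat.one_le_pow _ _ hLpos
  have hLrk : 1 ≤ L ^ i.r * L ^ i.kk := Nat.one_le_iff_ne_zero.mpr (Nat.mul_ne_zero (pow_ne_zero _ hLpos.ne') (pow_ne_zero _ hLpos.ne'))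
  have hLMdvd : ∀ μ, L ∣ cvM d L i.m i.kk hL μ := fun μ => by
    show L ∣ 2 * L ^ (i.m + 1)
    exact Dvd.dvd.mul_left (dvd_pow_self L (Nat.succ_ne_zero _)) 2
  have hd2 : 2 ≤ d + 1 := by omega
  obtain ⟨hZc, hZf⟩ := H i.m i.kk i.r i.one_le hw he
  have h1 : (sfInstance d mm ι hL i).Bf.one = (0 : Fin (d + 1) → CvX' d L i.m i.kk i.r hL → Matrix mm mm ℂ) := rfl
  haveI : NeZero (L ^ i.kk) := ⟨by omega⟩
  haveI : NeZero (L ^ i.r * L ^ i.kk) := ⟨by omega⟩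
  have hpow : L ^ i.r * L ^ i.kk = L ^ (i.kk + i.r) := by rw [pow_add, mul_comm]
  rw [h1, foCovSfLam_ker, hZc, hZf, exDress_zero (isUnit_det_smul_one_add_deltaCol _ ι _ a hLrk ha), exDress_zero (isUnit_det_smul_one_add_deltaCol _ ι _ a hLk ha), add_zero, add_zero,
    covCS_kron_one (isUnit_sandwich_subfamily hd2 hLpos hLMdvd hLrk _), covCS_kron_one (isUnit_sandwich_subfamily hd2 hLpos hLMdvd hLk _), kron_one_apply, kron_one_apply, covDiffLam,
    hpow]
  by_cases hj : j = j' <;> simp [hj]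

/-- ★ **COHERENCE OF THE TWO DIRICHLET EDITIONS — AT THE ZERO POTENTIAL THE U-LIVE DIRICHLET KERNEL OF (Ð-4) IS (Ð-6)'s U-BLIND DIRICHLET KERNEL OF RECORD `covOnSLam` TIMES `δ_{jj′}`**
(`d ≥ 1`, `L ≥ 7` odd, `a > 0`, indices with `L^m ≥ w₀`, trace-form-orthonormal `e`, ANY finite `Λ′₀`): the socket reading of `sfInstance` is Σ-E's (`sfTG`, `sfInstance_eq_opGeoS` rfl), the
region map is the constant one `fun _ => Λ'₀`. [cite: Balaban1984PropagatorsII, (2.156) p.250] -/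
theorem foCovSfLam_one_eq_covOnSLam (hd : 1 ≤ d) (hL : Odd L ∧ 1 < L) (hL7 : 7 ≤ L) (ha : 0 < a) (α β : Fin (d + 1)) (j j' : ι) :
    ∃ w₀ : ℝ, ∀ (i : SfIdx d L), w₀ ≤ ((L ^ i.m : ℕ) : ℝ) → (∀ A B : Matrix mm mm ℂ, traceForm A B = e A ⬝ᵥ e B) → ∀ (Λ'₀ : Finset (Fin (d + 1) → ℤ)) (y y' : Tor (cvM d L i.m i.kk hL)),
      (foCovSfLam d mm ι a e hL α β j j' i Λ'₀).ker (sfInstance d mm ι hL i).Bf.one y y' =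
        if j = j' then
          (covOnSLam d hL (sfTG d) (fun i => (L : ℝ) ^ i.m) (fun i => CvX d L i.m i.kk hL × ι) (fun i => liftBlk (cvBlk d L i.m i.kk hL) ι) (fun _ => Λ'₀) α β
              (fun i => (sfInstance d mm ι hL i).Bf) i).ker (sfInstance d mm ι hL i).Bf.one y y'
        else 0 := by
  obtain ⟨w₀, H⟩ := foCovSfLam_one d mm ι a e hd hL hL7 ha α β j j'
  refine ⟨w₀, fun i hw he Λ'₀ y y' => ?_⟩
  rw [H i hw he Λ'₀ y y', covOnSLam_ker]
  rfl


/-! ## §2 ★★★ The all-live knit with the Dirichlet region -/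

section Knit

/-- ★★★ **`Live ∧ N15At` FOR dag-n15-c's LIVE SMALL-FIELD FAMILY WITH ALL THREE LAYERS READING `A′` AND A GENUINE DIRICHLET REGION IN THE UNIT LAYER** (sub-family `SfIdxGE d L w × RegIdx0 d`):
`d ≥ 1`, odd `L ≥ 7`, `a, c₃₅ > 0`, trace-form-orthonormal `e`, `ι` nonempty; directions `μ₁ μ₂` (operator entries 1–2), `α β` + colours `j j′` (site bonds), `α′ β′` + colours `j₂ j₂′` (unit
bonds), any `p`: OPERATOR = Σ-F `ne2PlusOperator_sf₄cov`, SITE = (J-c) `ne2PlusSite_foSiteSf`, UNIT = (Ð-4) `ne2PlusUnit_foCovSfLam` (Dirichlet covariance of `Λ = B(Λ′₀)`, read on Λ: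
`inΛ := inLamSf`), GUARD = `live_sfGELam`. [bookkeeping] -/
theorem live_and_n15At_sf₄cov_allLiveLam [Nonempty ι] (hd : 1 ≤ d) (hL : Odd L ∧ 1 < L) (hL7 : 7 ≤ L) (ha : 0 < a) {c35 : ℝ} (hc35 : 0 < c35)
    (he : ∀ A B : Matrix mm mm ℂ, traceForm A B = e A ⬝ᵥ e B) (μ₁ μ₂ α β : Fin (d + 1)) (j j' : ι) (α' β' : Fin (d + 1)) (j₂ j₂' : ι) (p : ℝ) :
    ∃ w : ℝ,
      Live ⟨SfIdxGE d L w × RegIdx0 d, c35, p, fun x => sfInstance d mm ι hL x.1.1, fun x => sfFamily d mm ι a e hL x.1.1 (sfE₄cov d mm ι a e hL μ₁ μ₂ x.1.1),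
          fun x => foSiteSf d mm ι a e hL α β j j' x.1.1, fun x => foCovSfLam d mm ι a e hL α' β' j₂ j₂' x.1.1 x.2.1, fun x => inLamSf d mm ι hL x.1.1 x.2.1,
          fun x => (sfInstance d mm ι hL x.1.1).gc.dist⟩ ∧
      N15At { I := SfIdxGE d L w × RegIdx0 d, c35 := c35, p := p, pi := fun x => sfInstance d mm ι hL x.1.1,
              Kop := fun x => sfFamily d mm ι a e hL x.1.1 (sfE₄cov d mm ι a e hL μ₁ μ₂ x.1.1),
              Ksite := fun x => foSiteSf d mm ι a e hL α β j j' x.1.1, Kunit := fun x => foCovSfLam d mm ι a e hL α' β' j₂ j₂' x.1.1 x.2.1,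
              inΛ := fun x => inLamSf d mm ι hL x.1.1 x.2.1, unitDist := fun x => (sfInstance d mm ι hL x.1.1).gc.dist } := by
  obtain ⟨w, hunit⟩ := ne2PlusUnit_foCovSfLam d mm ι a e hd hL hL7 ha hc35 he α' β' j₂ j₂'
  exact ⟨w, live_sfGELam d mm ι hL w hc35.le p _ _ _,
    ⟨ne2PlusOperator_comp (fun x : SfIdxGE d L w × RegIdx0 d => x.1.1) (ne2PlusOperator_sf₄cov d mm ι e hL hL7 ha hc35 he μ₁ μ₂),
      ne2PlusSite_comp (fun x : SfIdxGE d L w × RegIdx0 d => x.1.1) (ne2PlusSite_foSiteSf d mm ι a e hL hL7 ha hc35 he α β j j' 4 p),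
      ne2PlusUnit_comp (fun x : SfIdxGE d L w × RegIdx0 d => ((x.1, x.2.1) : SfIdxGE d L w × Finset (Fin (d + 1) → ℤ))) hunit⟩⟩

/-! ## §3 The road-(c) literal with ALL layers U-live and the Dirichlet region (pinned threshold); keyed face -/

/-- **THE ROAD-(c) LITERAL WITH ALL THREE LAYERS U-LIVE AND A GENUINE DIRICHLET REGION** at a size threshold `w`: `NE2Objects₁₁` with n15-c's family on `SfIdxGE d L w × RegIdx0 d`, Σ-F's
operator layer, (J-c)'s site kernel, (Ð-4)'s Dirichlet unit kernel and region predicate. [bookkeeping] -/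
def sfObjects₄covLam (hL : Odd L ∧ 1 < L) (μ₁ μ₂ α β : Fin (d + 1)) (j j' : ι) (α' β' : Fin (d + 1)) (j₂ j₂' : ι) (c35 p w : ℝ) : NE2Objects₁₁ :=
  ⟨SfIdxGE d L w × RegIdx0 d, c35, p, fun x => sfInstance d mm ι hL x.1.1, fun x => sfFamily d mm ι a e hL x.1.1 (sfE₄cov d mm ι a e hL μ₁ μ₂ x.1.1),
    fun x => foSiteSf d mm ι a e hL α β j j' x.1.1, fun x => foCovSfLam d mm ι a e hL α' β' j₂ j₂' x.1.1 x.2.1, fun x => inLamSf d mm ι hL x.1.1 x.2.1,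
    fun x => (sfInstance d mm ι hL x.1.1).gc.dist⟩

/-- the record map reads the literal as the rates bundle (`rfl`). [bookkeeping] -/
theorem ne2OfRecord₁₁_sfObjects₄covLam (hL : Odd L ∧ 1 < L) (μ₁ μ₂ α β : Fin (d + 1)) (j j' : ι) (α' β' : Fin (d + 1)) (j₂ j₂' : ι) (c35 p w : ℝ) :
    ne2OfRecord₁₁ (sfObjects₄covLam d mm ι a e hL μ₁ μ₂ α β j j' α' β' j₂ j₂' c35 p w) =
      { I := SfIdxGE d L w × RegIdx0 d, c35 := c35, p := p, pi := fun x => sfInstance d mm ι hL x.1.1,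
        Kop := fun x => sfFamily d mm ι a e hL x.1.1 (sfE₄cov d mm ι a e hL μ₁ μ₂ x.1.1),
        Ksite := fun x => foSiteSf d mm ι a e hL α β j j' x.1.1, Kunit := fun x => foCovSfLam d mm ι a e hL α' β' j₂ j₂' x.1.1 x.2.1,
        inΛ := fun x => inLamSf d mm ι hL x.1.1 x.2.1, unitDist := fun x => (sfInstance d mm ι hL x.1.1).gc.dist } := rfl

/-- ★★ there IS a threshold at which the Dirichlet all-live literal passes the guard and `N15At` (restatement of `live_and_n15At_sf₄cov_allLiveLam` through the literal). [bookkeeping] -/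
theorem exists_live_and_n15At_sfObjects₄covLam [Nonempty ι] (hd : 1 ≤ d) (hL : Odd L ∧ 1 < L) (hL7 : 7 ≤ L) (ha : 0 < a) {c35 : ℝ} (hc35 : 0 < c35)
    (he : ∀ A B : Matrix mm mm ℂ, traceForm A B = e A ⬝ᵥ e B) (μ₁ μ₂ α β : Fin (d + 1)) (j j' : ι) (α' β' : Fin (d + 1)) (j₂ j₂' : ι) (p : ℝ) :
    ∃ w : ℝ, Live (ne2OfRecord₁₁ (sfObjects₄covLam d mm ι a e hL μ₁ μ₂ α β j j' α' β' j₂ j₂' c35 p w)) ∧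
      N15At (ne2OfRecord₁₁ (sfObjects₄covLam d mm ι a e hL μ₁ μ₂ α β j j' α' β' j₂ j₂' c35 p w)) :=
  live_and_n15At_sf₄cov_allLiveLam d mm ι a e hd hL hL7 ha hc35 he μ₁ μ₂ α β j j' α' β' j₂ j₂' p

/-- **THE PINNED THRESHOLD** `w_Λ` (a `Classical.choose` of the threshold of `exists_live_and_n15At_sfObjects₄covLam` — a NON-EXPLICIT cube floor, FILE 133's `w₀` being existential; depends on
`(d, L, mm, ι, a, e, c₃₅, directions, colours, p)` through the hypotheses it is chosen under). [bookkeeping] -/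
def wLam [Nonempty ι] (hd : 1 ≤ d) (hL : Odd L ∧ 1 < L) (hL7 : 7 ≤ L) (ha : 0 < a) {c35 : ℝ} (hc35 : 0 < c35) (he : ∀ A B : Matrix mm mm ℂ, traceForm A B = e A ⬝ᵥ e B)
    (μ₁ μ₂ α β : Fin (d + 1)) (j j' : ι) (α' β' : Fin (d + 1)) (j₂ j₂' : ι) (p : ℝ) : ℝ :=
  Classical.choose (exists_live_and_n15At_sfObjects₄covLam d mm ι a e hd hL hL7 ha hc35 he μ₁ μ₂ α β j j' α' β' j₂ j₂' p)

/-- ★★★ **GUARD ∧ `N15At` AT THE DIRICHLET ALL-LIVE LITERAL PINNED AT `w_Λ`** (`d ≥ 1`, odd `L ≥ 7`, `a, c₃₅ > 0`, trace-form-orthonormal `e`, `ι` nonempty) — a CLOSED literal with NO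
U-blind layer and NO `⊤` region. [bookkeeping] -/
theorem live_and_n15At_sfObjects₄covLam_wLam [Nonempty ι] (hd : 1 ≤ d) (hL : Odd L ∧ 1 < L) (hL7 : 7 ≤ L) (ha : 0 < a) {c35 : ℝ} (hc35 : 0 < c35)
    (he : ∀ A B : Matrix mm mm ℂ, traceForm A B = e A ⬝ᵥ e B) (μ₁ μ₂ α β : Fin (d + 1)) (j j' : ι) (α' β' : Fin (d + 1)) (j₂ j₂' : ι) (p : ℝ) :
    Live (ne2OfRecord₁₁ (sfObjects₄covLam d mm ι a e hL μ₁ μ₂ α β j j' α' β' j₂ j₂' c35 p (wLam d mm ι a e hd hL hL7 ha hc35 he μ₁ μ₂ α β j j' α' β' j₂ j₂' p))) ∧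
      N15At (ne2OfRecord₁₁ (sfObjects₄covLam d mm ι a e hL μ₁ μ₂ α β j j' α' β' j₂ j₂' c35 p (wLam d mm ι a e hd hL hL7 ha hc35 he μ₁ μ₂ α β j j' α' β' j₂ j₂' p))) :=
  Classical.choose_spec (exists_live_and_n15At_sfObjects₄covLam d mm ι a e hd hL hL7 ha hc35 he μ₁ μ₂ α β j j' α' β' j₂ j₂' p)

variable {N : ℕ} [NeZero N] {key : (F : T4Family) → Datum F N → Prop}

/-- ★★ **THE DIRICHLET ALL-LIVE LITERAL AT ANY KEYED HOME** (part 30's interface): a rate home over ANY key admitting only the literals of a key-indexed NE2 reading whose value everywhere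
is the pinned Dirichlet all-live literal has `S_N15 RRec` (`d ≥ 1`, odd `L ≥ 7`, `a, c₃₅ > 0`, trace-form-orthonormal `e`, `ι` nonempty). [bookkeeping] -/
theorem s_N15_of_admits_sf₄covLam [Nonempty ι] (hd : 1 ≤ d) (hL : Odd L ∧ 1 < L) (hL7 : 7 ≤ L) (ha : 0 < a) {c35 : ℝ} (hc35 : 0 < c35)
    (he : ∀ A B : Matrix mm mm ℂ, traceForm A B = e A ⬝ᵥ e B) (μ₁ μ₂ α β : Fin (d + 1)) (j j' : ι) (α' β' : Fin (d + 1)) (j₂ j₂' : ι) (p : ℝ)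
    (ne2At : ∀ {F : T4Family} {D : Datum F N}, key F D → (ℕ → ℝ) → List (ULoop F) → ℕ → NE2Objects₁₁) (RRec : RateRecordPred N)
    (hadm : ∀ (F : T4Family) (D : Datum F N) (g₀ : ℕ → ℝ) (os : List (ULoop F)) (R : RateCarriers N), RRec F D g₀ os R →
      ∃ (h : key F D) (k : ℕ), R.ne2 = ne2OfRecord₁₁ (ne2At h g₀ os k))
    (h : ∀ (F : T4Family) (D : Datum F N) (h : key F D) (g₀ : ℕ → ℝ) (os : List (ULoop F)) (k : ℕ),
      ne2At h g₀ os k = sfObjects₄covLam d mm ι a e hL μ₁ μ₂ α β j j' α' β' j₂ j₂' c35 p (wLam d mm ι a e hd hL hL7 ha hc35 he μ₁ μ₂ α β j j' α' β' j₂ j₂' p)) :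
    S_N15 RRec :=
  s_N15_of_admits ne2At RRec hadm fun F D hk g₀ os k => by
    rw [h F D hk g₀ os k]; exact (live_and_n15At_sfObjects₄covLam_wLam d mm ι a e hd hL hL7 ha hc35 he μ₁ μ₂ α β j j' α' β' j₂ j₂' p).2

end Knit

end Summit.QuantumFields.YangMills.BalabanUVNodes.N15.SiteLayerSf

end
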